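import Literature.Computability.Complexity.CodeFPBudgets
import HarnessLib

/-!
# Typed polynomial time on codes: finite tables, options, finite accumulators

Support file for the typed polynomial-time algebra `CodeFP` (`CodeFP.lean`, `CodeFPArith.lean`).
Three small families of combinators that every "arithmetic in a fixed finite field, on codes"
argument uses (first client: the machine level of the unique decoder of one-point AG codes over
`𝔽₆₄`, below `Literature.Barriers.PneNP.GSDecodableOnePoint64`):

* **finite tables** — `ofList`, `ofFintype`: EVERY map out of a finite type with decidable
  equality and an injective code is computed on codes in polynomial time (a finite chain of
  equality tests; the string function is a constant-size lookup table). In particular the field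
  operations, inversion, zero tests and coordinate maps of a fixed finite field such as `𝔽₆₄` need
  no arithmetic circuitry at all;
* **options** — the code `optE e` of `Option α` (`none ↦ ε`, `some a ↦ ⟨e a, ε⟩`, i.e. the raw code
  of `Option.toList`), with `optSome`, `optCases`, `optMap`, `optBind`, `rawHead?` and `rawFind?`
  (`List.find?` as `head?` of a `filter`);
* **folds with a finite accumulator** — `foldlFin`, `foldlFin₀`: the bound hypothesis of
  `CodeFP.foldl` discharged once and for all when the accumulator ranges over a finite type
  (constant bound `maxLen e = max |e b|`), whence `listSum` (sums of lists over a finite additive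
  monoid).

## References

* S. Arora, B. Barak, *Computational Complexity: A Modern Approach*, CUP 2009, §1.3 (polynomial
  time: closure under composition and bounded loops; finite functions are trivially computable).
-/

namespace Literature.Computability.Complexity

namespace CodeFP

open Polynomial

variable {α β γ δ σ : Type}
variable {eα : α → List Bool} {eβ : β → List Bool} {eγ : γ → List Bool} {eδ : δ → List Bool}
  {eσ : σ → List Bool}

/-! ### Finite tables -/

/-- A map agreeing with `g` on a finite list of arguments (and constant elsewhere) is computed on
codes by a chain of equality tests. [cite: AroraBarak2009, §1.3] -/
theorem ofList [DecidableEq α] (he : Function.Injective eα) (eβ : β → List Bool) (g : α → β)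
    (d : β) : ∀ l : List α, CodeFP eα eβ (fun a => if a ∈ l then g a else d)
  | [] => (const eα d).congr fun a => by simp
  | b :: l => by
    have htest : CodeFP eα bitE (fun a => decide (a = b)) :=
      (eq he).comp ((CodeFP.id eα).pair (const eα b))
    exact (htest.ite (const eα (g b)) (ofList he eβ g d l)).congr fun a => by
      by_cases hab : a = b
      · subst hab; simp
      · simp [hab]

/-- **Every map out of a finite type is computed on codes in polynomial time** (for an injective
code with decidable equality): a finite lookup table. [cite: AroraBarak2009, §1.3] -/
theorem ofFintype [Fintype α] [DecidableEq α] (he : Function.Injective eα) (eβ : β → List Bool)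
    (g : α → β) : CodeFP eα eβ g := by
  cases isEmpty_or_nonempty α with
  | inl h => exact ⟨_root_.id, PolyTimeComputable.id _, fun a => (IsEmpty.false a).elim⟩
  | inr h =>
    obtain ⟨a₀⟩ := h
    exact (ofList he eβ g (g a₀) Finset.univ.toList).congr fun a => by simp

/-- Binary maps out of finite types. [cite: AroraBarak2009, §1.3] -/
theorem ofFintype₂ [Fintype α] [DecidableEq α] [Fintype β] [DecidableEq β]
    (hα : Function.Injective eα) (hβ : Function.Injective eβ) (eγ : γ → List Bool) (g : α × β → γ) :
    CodeFP (pairE eα eβ) eγ g :=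
  ofFintype (pairE_injective hα hβ) eγ g

/-- The longest code of an element of a finite type. [folklore] -/
def maxLen [Fintype β] (eβ : β → List Bool) : ℕ := Finset.univ.sup fun b => (eβ b).length

/-- Every code is at most `maxLen` long. [folklore] -/
theorem length_le_maxLen [Fintype β] (eβ : β → List Bool) (b : β) : (eβ b).length ≤ maxLen eβ :=
  Finset.le_sup (f := fun b => (eβ b).length) (Finset.mem_univ b)

/-- A raw list over a finite type has code length at most `|l| · (2 maxLen + 2)`. [folklore] -/
theorem length_rawE_le_of_fintype [Fintype β] (eβ : β → List Bool) (l : List β) :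
    (rawE eβ l).length ≤ l.length * (2 * maxLen eβ + 2) := by
  induction l with
  | nil => simp
  | cons b l ih =>
    rw [rawE_cons, length_boolPair, List.length_cons]
    have := length_le_maxLen eβ b
    nlinarith

/-! ### Folds with a finite accumulator -/

/-- **Left fold with a context whose accumulator lives in a finite type**: no bound to discharge.
[cite: AroraBarak2009, §1.3 (bounded loops)] -/
theorem foldlFin [Fintype β] {step : σ → α → β → β} {init : σ → β}
    (hstep : CodeFP (pairE eσ (pairE eα eβ)) eβ (fun t => step t.1 t.2.1 t.2.2))
    (hinit : CodeFP eσ eβ init) :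
    CodeFP (pairE eσ (rawE eα)) eβ (fun p => p.2.foldl (fun b a => step p.1 a b) (init p.1)) :=
  foldl hstep hinit (maxLen eβ : Polynomial ℕ) fun s l₁ l₂ => by
    rw [eval_natCast]; exact length_le_maxLen eβ _

/-- Context-free fold with a finite accumulator. [cite: AroraBarak2009, §1.3 (bounded loops)] -/
theorem foldlFin₀ [Fintype β] {step : α → β → β} {b₀ : β}
    (hstep : CodeFP (pairE eα eβ) eβ (fun t => step t.1 t.2)) :
    CodeFP (rawE eα) eβ (fun l => l.foldl (fun b a => step a b) b₀) := by
  have h := foldlFin (σ := Unit) (eσ := fun _ => []) (step := fun _ a b => step a b)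
    (init := fun _ => b₀) (hstep.comp (snd _ _)) (const _ b₀)
  exact h.comp ((const (rawE eα) ()).pair (CodeFP.id (rawE eα)))

/-- **Sums of lists over a finite additive monoid** (e.g. a finite field). [cite: AroraBarak2009, §1.3] -/
theorem listSum [Fintype β] [DecidableEq β] [AddCommMonoid β] (he : Function.Injective eβ) :
    CodeFP (rawE eβ) eβ List.sum :=
  (foldlFin₀ (step := fun a b => b + a) (b₀ := (0 : β))
    (ofFintype₂ he he eβ fun t => t.2 + t.1)).congr fun l => by
      rw [List.sum_eq_foldl]

/-! ### Options -/

/-- The code of an option: the raw code of `Option.toList` (`none ↦ ε`, `some a ↦ ⟨e a, ε⟩`). [folklore] -/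
def optE (e : α → List Bool) : Option α → List Bool := fun o => rawE e o.toList

/-- `optE e none = ε`. [folklore] -/
@[simp] theorem optE_none (e : α → List Bool) : optE e none = [] := rfl

/-- `optE e (some a) = ⟨e a, ε⟩`. [folklore] -/
@[simp] theorem optE_some (e : α → List Bool) (a : α) : optE e (some a) = boolPair (e a) [] := rfl

/-- `optE e o` is the raw code of `o.toList`. [folklore] -/
theorem optE_eq (e : α → List Bool) (o : Option α) : optE e o = rawE e o.toList := rfl

/-- The option code is injective for an injective item code. [folklore] -/
theorem optE_injective (he : Function.Injective eα) : Function.Injective (optE eα) := by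
  intro o o' h
  have := rawE_injective he h
  cases o <;> cases o' <;> simp_all

/-- `some`. [folklore] -/
theorem optSome (eα : α → List Bool) : CodeFP eα (optE eα) some := rawSingleton eα

/-- `Option.toList` is the identity on codes. [folklore] -/
theorem optToList (eα : α → List Bool) : CodeFP (optE eα) (rawE eα) Option.toList :=
  ⟨_root_.id, PolyTimeComputable.id _, fun _ => rfl⟩

/-- A raw list of length `≤ 1` read as an option (`[] ↦ none`, `a :: _ ↦ some a`): `List.head?`.
[folklore] -/
theorem rawHead? (eα : α → List Bool) : CodeFP (rawE eα) (optE eα) List.head? := by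
  have h := rawCases (σ := Unit) (eσ := fun _ => []) (eα := eα) (eδ := rawE eα)
    (k := fun _ l => l.head?.toList) (gnil := fun _ => []) (gcons := fun t => [t.2.1])
    (const _ []) ((rawSingleton eα).comp (snd _ _).fst') (fun _ => rfl) (fun _ _ _ => rfl)
  exact (h.comp ((const _ ()).pair (CodeFP.id _))).congr fun l => rfl

/-- **Case analysis on an option** with a context. [folklore] -/
theorem optCases {k : σ → Option α → δ} {gnone : σ → δ} {gsome : σ × α → δ}
    (hnone : CodeFP eσ eδ gnone) (hsome : CodeFP (pairE eσ eα) eδ gsome)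
    (hk0 : ∀ s, k s none = gnone s) (hk1 : ∀ s a, k s (some a) = gsome (s, a)) :
    CodeFP (pairE eσ (optE eα)) eδ (fun p => k p.1 p.2) := by
  have h := rawCases (eσ := eσ) (eα := eα) (eδ := eδ) (k := fun s l => k s l.head?)
    (gnil := gnone) (gcons := fun t => gsome (t.1, t.2.1)) hnone
    (hsome.comp ((fst _ _).pair (snd _ _).fst')) (fun s => hk0 s) (fun s a l => hk1 s a)
  exact (h.comp ((fst _ _).pair ((optToList eα).comp (snd _ _)))).congr fun p => by
    cases p.2 <;> rfl

/-- **`Option.map` with a context.** [folklore] -/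
theorem optMap {g : σ × α → β} (hg : CodeFP (pairE eσ eα) eβ g) :
    CodeFP (pairE eσ (optE eα)) (optE eβ) (fun p => p.2.map fun a => g (p.1, a)) :=
  optCases (k := fun s o => o.map fun a => g (s, a)) (const eσ none) ((optSome eβ).comp hg)
    (fun _ => rfl) (fun _ _ => rfl)

/-- **`Option.bind` with a context.** [folklore] -/
theorem optBind {g : σ × α → Option β} (hg : CodeFP (pairE eσ eα) (optE eβ) g) :
    CodeFP (pairE eσ (optE eα)) (optE eβ) (fun p => p.2.bind fun a => g (p.1, a)) :=
  optCases (k := fun s o => o.bind fun a => g (s, a)) (const eσ none) hg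
    (fun _ => rfl) (fun _ _ => rfl)

/-- `Option.isSome`. [folklore] -/
theorem optIsSome (eα : α → List Bool) : CodeFP (optE eα) bitE Option.isSome :=
  ((rawIsEmpty eα).comp (optToList eα)).not.congr fun o => by cases o <;> rfl

/-- **`List.find?` with a context** on raw lists. [cite: AroraBarak2009, §1.3] -/
theorem rawFind? {p : σ × α → Bool} (hp : CodeFP (pairE eσ eα) bitE p) :
    CodeFP (pairE eσ (rawE eα)) (optE eα) (fun q => q.2.find? fun a => p (q.1, a)) :=
  ((rawHead? eα).comp (filter hp)).congr fun _ => List.head?_filter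

end CodeFP

end Literature.Computability.Complexity
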